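import Mathlib.Analysis.Analytic.IsolatedZeros
import Mathlib.Analysis.Complex.CauchyIntegral
import Mathlib.Topology.Connected.LocallyConnected

/-!
# A relatively proper holomorphic map is nowhere locally constant

Crux `WitnessCharge` (statement item `stmt-SmoothPoincare4-7824`), line `Sketch`,
stub `helper_properHolo_notLocallyConstant` (degree theory of proper holomorphic maps between
planar open sets, part 2).

Let `Z` be holomorphic on an open set `U ⊆ ℂ`, mapping `U` into `A`, and *relatively proper*:
`U ∩ Z ⁻¹' K` is compact for every compact `K ⊆ A`. Then `Z` is not eventually constant at any
point of `U`.

The proof is the identity theorem on the connected component `C` of the point `ξ` in `U`: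
if `Z = Z ξ` near `ξ`, then `Z = Z ξ` on `C`, so `C` lies in the compact (hence closed) fibre
`U ∩ Z ⁻¹' {Z ξ}`; therefore `closure C ⊆ U` is preconnected and contains `ξ`, whence
`closure C ⊆ C`, i.e. `C` is closed. Being also open (`ℂ` is locally connected) and nonempty,
`C = ℂ`, so `ℂ` would be contained in a compact set, contradicting `NoncompactSpace ℂ`.

## Main results

* `helper_properHolo_notLocallyConstant`: a relatively proper holomorphic map on an open subset
  of `ℂ` is nowhere locally constant.
-/

noncomputable section

set_option linter.dupNamespace false

open Set Filter Topology Metric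

namespace Summit.SmoothPoincare4.SmoothPoincare4.Theorems.WitnessCharge.PencilIncompleteness

/-- **A relatively proper holomorphic map is nowhere locally constant.** Let `Z : ℂ → ℂ` be
complex differentiable on the open set `U`, with `Z '' U ⊆ A`, and assume that `U ∩ Z ⁻¹' K` is
compact for every compact `K ⊆ A` (properness of `Z : U → A`). Then for every `ξ ∈ U` the map `Z`
is not eventually equal to `Z ξ` near `ξ`. Indeed, otherwise the identity theorem forces
`Z = Z ξ` on the connected component of `ξ` in `U`, which is then both open and closed in `ℂ`,
hence all of `ℂ`, and `ℂ = U ∩ Z ⁻¹' {Z ξ}` would be compact. -/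
theorem helper_properHolo_notLocallyConstant :
    ∀ (Z : ℂ → ℂ) (U A : Set ℂ), IsOpen U → DifferentiableOn ℂ Z U → MapsTo Z U A →
      (∀ K ⊆ A, IsCompact K → IsCompact (U ∩ Z ⁻¹' K)) →
      ∀ ξ ∈ U, ¬ (∀ᶠ z in 𝓝 ξ, Z z = Z ξ) := by
  intro Z U A hU hZ hA hP ξ hξ hconst
  -- `Z` is analytic on the open set `U`.
  have hZan : AnalyticOnNhd ℂ Z U := hZ.analyticOnNhd hU
  -- The connected component `C` of `ξ` in `U`.
  have hCU : connectedComponentIn U ξ ⊆ U := connectedComponentIn_subset U ξ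
  have hξC : ξ ∈ connectedComponentIn U ξ := mem_connectedComponentIn hξ
  have hCpre : IsPreconnected (connectedComponentIn U ξ) := isPreconnected_connectedComponentIn
  -- Identity theorem: `Z = Z ξ` on `C`.
  have hEq : EqOn Z (fun _ => Z ξ) (connectedComponentIn U ξ) :=
    (hZan.mono hCU).eqOn_of_preconnected_of_eventuallyEq analyticOnNhd_const hCpre hξC hconst
  -- The fibre over `Z ξ` is compact, and contains `C`.
  have hLcpt : IsCompact (U ∩ Z ⁻¹' {Z ξ}) :=
    hP {Z ξ} (singleton_subset_iff.2 (hA hξ)) isCompact_singleton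
  have hCL : connectedComponentIn U ξ ⊆ U ∩ Z ⁻¹' {Z ξ} := fun z hz => ⟨hCU hz, hEq hz⟩
  -- Hence `closure C ⊆ U`, so `closure C ⊆ C`: the component is closed.
  have hCclosed : IsClosed (connectedComponentIn U ξ) :=
    closure_subset_iff_isClosed.1 <|
      hCpre.closure.subset_connectedComponentIn (subset_closure hξC)
        ((closure_minimal hCL hLcpt.isClosed).trans inter_subset_left)
  -- It is also open and nonempty, hence everything.
  have hCuniv : connectedComponentIn U ξ = univ :=
    IsClopen.eq_univ ⟨hCclosed, hU.connectedComponentIn⟩ ⟨ξ, hξC⟩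
  have huniv : (univ : Set ℂ) ⊆ U ∩ Z ⁻¹' {Z ξ} := by
    rw [← hCuniv]
    exact hCL
  -- So `ℂ` would be compact: contradiction.
  exact noncompact_univ ℂ (hLcpt.of_isClosed_subset isClosed_univ huniv)

end Summit.SmoothPoincare4.SmoothPoincare4.Theorems.WitnessCharge.PencilIncompleteness
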